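import Summits.QuantumFields.YangMills.Theorems.BalabanLadderUVSeamRecClassicalResponseThermalFloor
import Summits.QuantumFields.YangMills.Theorems.BalabanLadderUVSeamRecClassicalResponseSemiclassical
import Summits.QuantumFields.YangMills.Theorems.BalabanLadderUVSeamRecClassicalResponseDirichlet
import Summits.QuantumFields.YangMills.Theorems.BalabanLadderUVSeamRecUnitTransfer
import HarnessLib

/-!
# Crux `UVSeamRec` (stmt-QuantumFields-20043): the flag-free classical split cannot have a CONSTANT reference value —
# the reference must absorb the `Θ(1/β)` thermal deficit of the cold-wall kernel

Helper file (`--supports stmt-QuantumFields-20043`) of the LEAD seat `ym-spine-20043-p1` (gen 10), part 3 of the «thermal floor» files; sequel of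
`…ClassicalResponseThermalFloor` (`kerE_deficit_ge`: `6/(24β+3) ≤ kerE^η(2 − plane)` for every exterior), of the LEAD's fixed-scale split
(`…ClassicalResponseSemiclassical`, p590468: `pureSplit_fixedScale` with the trivial reference `p ≡ N`) and of tempered-d1's `…ClassicalResponseDirichlet`
(`PureSplitCl`, `carrierCl_one`, the Dirichlet rate law `DirichletRate`).

WHAT IS PROVED (`SU(2)`, fundamental representation, unit of record `uRec`).
* **`pureSplitCl_ref_le`** — tempered-d1's flag-free split `PureSplitCl C_s C₁ A₀ β₁ ℓ₁ p` with `C₁ > 0` forces, at every admissible `(β, R)`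
  (`β ≥ β₁`, `β ≥ 0`, `1 ≤ R`, `R·uRec β ≤ ℓ₁`) and every orientation, `p q β ≤ 2 − 6/(24β+3) + A₀C₁/R⁴` (evaluate the split at the identity exterior,
  where the classical carrier vanishes, and use part 2's thermal floor of the cold-wall kernel).
* `tendsto_mul_uRec_pow_four` — `β·uRec(β)⁴ → 0` (the unit of record decays exponentially: `log uRec = −β/(4b₀) + O(log β)`).
* **`not_pureSplitCl_const_two`** — for all `C_s`, `C₁ > 0`, `A₀`, `β₁`, `ℓ₁ > 0`: `¬ PureSplitCl C_s C₁ A₀ β₁ ℓ₁ (fun _ _ => 2)`.  Along the record's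
  scale window `R ≤ ℓ₁/uRec β` the Dirichlet tolerance `A₀C₁/R⁴` falls below the thermal floor `6/(24β+3)`.

READING.  The reference value `p q β` of (split-cl)/(BF) is ∃-quantified and may depend on `β` (not on `R`); this file shows it MUST: it has to track the
`Θ(1/β)` cold-wall plaquette mean (perturbatively `N − 3/(4β) + …`), uniformly to `O(A₀C₁/R⁴)` over the window — tempered-d1's Dirichlet rate law read
from below.  Consequently the LEAD's fixed-scale split with `p ≡ N` (p590468) has an onset growing at least like `β₁(R) ≳ R⁴/(A₀C₁)`, and any
logarithmic-onset upgrade (the renormalisation-group content of (split-cl)) must come with the perturbative reference value.  HONEST FRAMING: a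
NECESSARY CONDITION on the witness of an OPEN stub, not a refutation of anything registered; nothing of E0′, NT or the gap; not Clay.
-/

set_option autoImplicit false

noncomputable section

open scoped Matrix
open MeasureTheory Filter Topology ProbabilityTheory
open Literature.MathematicalPhysics.QuantumFieldTheory (LatticeRep haarProbability staple stapleSum re_trace_holonomy_update
  wilsonBoundaryAction_singleton_update card_plaquettesTouching_singleton_le plaquetteEdges_eq plaqLink1
  isSpecification_ymSpecification_of_t2Space mem_plaquettesTouching_singleton)
open Literature.MathematicalPhysics.QuantumLattice (LGConfig ZdEdge ZdPlaquette ymSpecification wilsonBoundaryAction plaquettesTouching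
  plaquetteEdges plaquetteHolonomyZd quatMatrix su2Quat quatMatrix_su2Quat norm_su2Quat quatMatrix_smul quatMatrix_mem_specialUnitaryGroup
  integral_ymSpecification isProbabilityMeasure_ymSpecification continuous_wilsonBoundaryAction continuous_integral_ymSpecification
  abs_integral_ymSpecification_le fundamentalRep fundamentalRep_apply fundamentalRep_mem_unitaryGroup fundamentalLatticeRep)
open Literature.Probability.LatticeModels (glueWith glueWith_apply_mem glueWith_apply_not_mem IsSpecification)
open Summit.QuantumFields.YangMills.Cruxes.OSLegsFromFemtoAndGap.DlrCollarTransfer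
open Summit.QuantumFields.YangMills.Cruxes.NT.BoundaryLaw (plane_eq_plaquetteObs)

namespace Summit.QuantumFields.YangMills.Cruxes.UVSeamRec.ClassicalResponse.ThermalFloor

/-! ## §6 Consequences for the flag-free classical split: the reference value must absorb the thermal deficit -/

/-- **(split-cl) pins the reference value below `N − Θ(1/β)`**: tempered-d1's `PureSplitCl C_s C₁ A₀ β₁ ℓ₁ p` with `C₁ > 0` forces, at every
admissible `(β, R)` (`β ≥ β₁`, `β ≥ 0`, `1 ≤ R`, `R·uRec β ≤ ℓ₁`) and every orientation, `p q β ≤ 2 − 6/(24β+3) + A₀·C₁/R⁴` (evaluate the split at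
the identity exterior, where the classical carrier vanishes — `carrierCl_one` — and use §5's thermal floor of the cold-wall kernel). [folklore] -/
theorem pureSplitCl_ref_le {C_s C₁ A₀ β₁ ℓ₁ : ℝ} {p : Fin 4 × Fin 4 → ℝ → ℝ} (h : PureSplitCl C_s C₁ A₀ β₁ ℓ₁ p) (hC₁ : 0 < C₁)
    {β : ℝ} (hβ₁ : β₁ ≤ β) (hβ : 0 ≤ β) {R : ℕ} (hR : 1 ≤ R) (hRu : (R : ℝ) * Transport.uRec β ≤ ℓ₁)
    (q : Fin 4 × Fin 4) (hq : q.1 < q.2) :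
    p q β ≤ 2 - 6 / (24 * β + 3) + A₀ * C₁ / (R : ℝ) ^ 4 := by
  have hR4 : (0 : ℝ) < (R : ℝ) ^ 4 := by positivity
  have h1 := h β hβ₁ R hR hRu q 0 hq 1
  rw [carrierCl_one (fundamentalLatticeRep 2) C_s β R q hq 0, add_zero] at h1
  -- `|kerE(plane) − p| ≤ A₀C₁/R⁴`
  have h2 : |kerE (Matrix.specialUnitaryGroup (Fin 2) ℂ) (fundamentalLatticeRep 2) β (fun k => (0 : Fin 4 → ℤ) k - (R + 1)) (2 * R + 3) 1
      (plane (Matrix.specialUnitaryGroup (Fin 2) ℂ) (fundamentalLatticeRep 2) q 0) - p q β| ≤ A₀ * C₁ / (R : ℝ) ^ 4 := by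
    rw [le_div_iff₀ hR4]
    have := mul_le_mul_of_nonneg_left h1 hC₁.le
    calc |kerE (Matrix.specialUnitaryGroup (Fin 2) ℂ) (fundamentalLatticeRep 2) β (fun k => (0 : Fin 4 → ℤ) k - (R + 1)) (2 * R + 3) 1
          (plane (Matrix.specialUnitaryGroup (Fin 2) ℂ) (fundamentalLatticeRep 2) q 0) - p q β| * (R : ℝ) ^ 4
        = C₁ * ((R : ℝ) ^ 4 / C₁ * |kerE (Matrix.specialUnitaryGroup (Fin 2) ℂ) (fundamentalLatticeRep 2) β
            (fun k => (0 : Fin 4 → ℤ) k - (R + 1)) (2 * R + 3) 1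
            (plane (Matrix.specialUnitaryGroup (Fin 2) ℂ) (fundamentalLatticeRep 2) q 0) - p q β|) := by
          field_simp
      _ ≤ C₁ * A₀ := this
      _ = A₀ * C₁ := mul_comm _ _
  -- the thermal floor of the cold-wall kernel
  have h3 := kerE_deficit_ge hβ R q hq 0 (1 : LGConfig 4 (Matrix.specialUnitaryGroup (Fin 2) ℂ))
  rw [kerE_const_sub (fundamentalLatticeRep 2) β _ _ 1 (continuous_plane (fundamentalLatticeRep 2) q 0)] at h3
  have h4 := (abs_le.1 h2).1
  linarith

/-- **`β·uRec(β)⁴ → 0`**: the unit of record decays exponentially (`log uRec = −β/(4b₀) + O(log β)`), faster than any power. [folklore] -/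
theorem tendsto_mul_uRec_pow_four : Tendsto (fun β : ℝ => β * Transport.uRec β ^ 4) atTop (𝓝 0) := by
  have hb0 : (0 : ℝ) < Summit.QuantumFields.YangMills.Theorems.FemtoTransferGap.b0 := by
    unfold Summit.QuantumFields.YangMills.Theorems.FemtoTransferGap.b0; positivity
  set B0 : ℝ := Summit.QuantumFields.YangMills.Theorems.FemtoTransferGap.b0 with hB0
  set K : ℝ := Summit.QuantumFields.YangMills.Theorems.FemtoTransferGap.b1 / (2 * B0 ^ 2) with hK
  -- the exponent `log β + 4·sizeLog β 1 = −β/B0 + ((4K+1) log β − 4K log(2B0)) → −∞`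
  have hf : Tendsto (fun β : ℝ => -(β / B0)) atTop atBot :=
    tendsto_neg_atTop_atBot.comp (tendsto_id.atTop_div_const hb0)
  have hg : (fun β : ℝ => (4 * K + 1) * Real.log β - 4 * K * Real.log (2 * B0)) =o[atTop] (fun β : ℝ => -(β / B0)) := by
    have h1 : (fun β : ℝ => (4 * K + 1) * Real.log β - 4 * K * Real.log (2 * B0)) =o[atTop] (fun β : ℝ => β) := by
      have hlog : (fun β : ℝ => (4 * K + 1) * Real.log β) =o[atTop] (fun β : ℝ => β) :=
        Real.isLittleO_log_id_atTop.const_mul_left _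
      have hc : (fun _ : ℝ => 4 * K * Real.log (2 * B0)) =o[atTop] (fun β : ℝ => β) :=
        Asymptotics.isLittleO_const_left.2
          (Or.inr (show Tendsto (fun β : ℝ => ‖β‖) atTop atTop from tendsto_norm_atTop_atTop))
      exact hlog.sub hc
    have h2 : (fun β : ℝ => β) =O[atTop] (fun β : ℝ => -(β / B0)) := by
      refine Asymptotics.IsBigO.of_bound B0 (Eventually.of_forall fun β => ?_)
      rw [norm_neg, norm_div, Real.norm_of_nonneg hb0.le, mul_div_cancel₀ _ hb0.ne']
    exact h1.trans_isBigO h2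
  have hsum : Tendsto ((fun β : ℝ => -(β / B0)) + fun β : ℝ => (4 * K + 1) * Real.log β - 4 * K * Real.log (2 * B0))
      atTop atBot :=
    ((Asymptotics.IsEquivalent.refl.add_isLittleO hg).symm).tendsto_atBot hf
  have hexp := Real.tendsto_exp_atBot.comp hsum
  refine hexp.congr' ?_
  filter_upwards [eventually_gt_atTop (0 : ℝ)] with β hβ
  simp only [Function.comp_apply, Pi.add_apply, Transport.uRec, Summit.QuantumFields.YangMills.Theorems.FemtoTransferGap.sizeLog,
    hK, hB0, Nat.cast_one, Real.log_one]
  rw [← Real.exp_nat_mul, ← Real.exp_log hβ, ← Real.exp_add, Real.exp_log hβ, Real.log_div (mul_pos two_pos hb0).ne' hβ.ne']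
  congr 1
  push_cast
  ring

/-- **THE CONSTANT REFERENCE IS INADMISSIBLE**: for all `C_s`, `C₁ > 0`, `A₀`, `β₁` and `ℓ₁ > 0`, tempered-d1's flag-free classical split with
the constant reference value `p ≡ 2 = N` is FALSE — along the record's scale window `R ≤ ℓ₁/uRec β` the Dirichlet tolerance `A₀C₁/R⁴` falls below
the thermal floor `6/(24β+3)` (`β·uRec(β)⁴ → 0`).  The reference value of (split-cl) must track the `Θ(1/β)` cold-wall plaquette mean. [folklore] -/
theorem not_pureSplitCl_const_two {C_s C₁ A₀ β₁ ℓ₁ : ℝ} (hC₁ : 0 < C₁) (hℓ₁ : 0 < ℓ₁) :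
    ¬ PureSplitCl C_s C₁ A₀ β₁ ℓ₁ (fun _ _ => 2) := by
  intro h
  -- eventually: `uRec β ≤ ℓ₁/2` and `β·uRec⁴ ≤ c`, with `c` small
  have hA : 0 ≤ A₀ * C₁ ∨ A₀ * C₁ < 0 := le_or_gt _ _
  set c : ℝ := ℓ₁ ^ 4 / (16 * 27 * (A₀ * C₁ + 1) + 1) with hc
  have h27pos : (0 : ℝ) < 16 * 27 * (|A₀ * C₁| + 1) + 1 := by positivity
  have hev1 : ∀ᶠ β : ℝ in atTop, Transport.uRec β ≤ ℓ₁ / 2 :=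
    (UnitTransfer.tendsto_uRec.eventually (Iic_mem_nhds (by positivity : (0 : ℝ) < ℓ₁ / 2)))
  have hev2 : ∀ᶠ β : ℝ in atTop, β * Transport.uRec β ^ 4 ≤ ℓ₁ ^ 4 / (16 * 27 * (|A₀ * C₁| + 1) + 1) :=
    tendsto_mul_uRec_pow_four.eventually (Iic_mem_nhds (by positivity))
  obtain ⟨β, hβ⟩ := (hev1.and (hev2.and ((eventually_ge_atTop (max β₁ 1)).and (eventually_ge_atTop (1 : ℝ))))).exists
  obtain ⟨hu, hβu, hβmax, hβ1⟩ := hβ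
  have hβ₁ : β₁ ≤ β := (le_max_left _ _).trans hβmax
  have hβ0 : 0 ≤ β := by linarith
  have hupos : 0 < Transport.uRec β := UnitTransfer.uRec_pos β
  -- the scale `R := ⌊ℓ₁ / uRec β⌋₊`
  set R : ℕ := ⌊ℓ₁ / Transport.uRec β⌋₊ with hRdef
  have hquot : 2 ≤ ℓ₁ / Transport.uRec β := by
    rw [le_div_iff₀ hupos]; linarith
  have hR1 : 1 ≤ R := by
    rw [hRdef]
    exact Nat.one_le_iff_ne_zero.2 (Nat.pos_iff_ne_zero.1 (Nat.floor_pos.2 (by linarith)))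
  have hRle : (R : ℝ) ≤ ℓ₁ / Transport.uRec β := Nat.floor_le (by positivity)
  have hRu : (R : ℝ) * Transport.uRec β ≤ ℓ₁ := by rwa [← le_div_iff₀ hupos]
  have hRge : ℓ₁ / (2 * Transport.uRec β) ≤ (R : ℝ) := by
    have hlt := Nat.lt_floor_add_one (ℓ₁ / Transport.uRec β)
    rw [← hRdef] at hlt
    rw [div_le_iff₀ (by positivity)]
    rw [le_div_iff₀ hupos] at hquot
    have : ℓ₁ / Transport.uRec β < R + 1 := hlt
    rw [div_lt_iff₀ hupos] at this
    nlinarith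
  -- the reference bound at `(β, R)` with `p ≡ 2`
  have href := pureSplitCl_ref_le h hC₁ hβ₁ hβ0 hR1 hRu (0, 1) (by decide)
  have hfloor : 6 / (24 * β + 3) ≤ A₀ * C₁ / (R : ℝ) ^ 4 := by linarith
  -- contradiction: `A₀C₁/R⁴ ≤ 16 A₀C₁ uRec⁴/ℓ₁⁴ < 6/(24β+3)`
  have hR4 : ℓ₁ ^ 4 / (16 * Transport.uRec β ^ 4) ≤ (R : ℝ) ^ 4 := by
    have h := pow_le_pow_left₀ (by positivity) hRge 4
    calc ℓ₁ ^ 4 / (16 * Transport.uRec β ^ 4) = (ℓ₁ / (2 * Transport.uRec β)) ^ 4 := by ring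
      _ ≤ (R : ℝ) ^ 4 := h
  have hRpos : (0 : ℝ) < (R : ℝ) ^ 4 := by positivity
  have h6 : (0 : ℝ) < 6 / (24 * β + 3) := by positivity
  rcases hA with hA0 | hAneg
  · -- `A₀C₁ ≥ 0`
    have hR4' : ℓ₁ ^ 4 ≤ (R : ℝ) ^ 4 * (16 * Transport.uRec β ^ 4) := (div_le_iff₀ (by positivity)).1 hR4
    have hb1 : A₀ * C₁ / (R : ℝ) ^ 4 ≤ A₀ * C₁ * (16 * Transport.uRec β ^ 4) / ℓ₁ ^ 4 := by
      rw [div_le_div_iff₀ hRpos (by positivity)]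
      calc A₀ * C₁ * ℓ₁ ^ 4 ≤ A₀ * C₁ * ((R : ℝ) ^ 4 * (16 * Transport.uRec β ^ 4)) := mul_le_mul_of_nonneg_left hR4' hA0
        _ = A₀ * C₁ * (16 * Transport.uRec β ^ 4) * (R : ℝ) ^ 4 := by ring
    have habs : |A₀ * C₁| = A₀ * C₁ := abs_of_nonneg hA0
    rw [habs] at hβu
    have hKpos : (0 : ℝ) < 16 * 27 * (A₀ * C₁ + 1) + 1 := by positivity
    have hβu' : β * Transport.uRec β ^ 4 * (16 * 27 * (A₀ * C₁ + 1) + 1) ≤ ℓ₁ ^ 4 := (le_div_iff₀ hKpos).1 hβu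
    have hb2 : A₀ * C₁ * (16 * Transport.uRec β ^ 4) / ℓ₁ ^ 4 ≤ 16 * A₀ * C₁ / ((16 * 27 * (A₀ * C₁ + 1) + 1) * β) := by
      rw [div_le_div_iff₀ (by positivity) (by positivity)]
      calc A₀ * C₁ * (16 * Transport.uRec β ^ 4) * ((16 * 27 * (A₀ * C₁ + 1) + 1) * β)
          = 16 * (A₀ * C₁) * (β * Transport.uRec β ^ 4 * (16 * 27 * (A₀ * C₁ + 1) + 1)) := by ring
        _ ≤ 16 * (A₀ * C₁) * ℓ₁ ^ 4 := mul_le_mul_of_nonneg_left hβu' (by positivity)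
        _ = 16 * A₀ * C₁ * ℓ₁ ^ 4 := by ring
    have hb3 : 16 * A₀ * C₁ / ((16 * 27 * (A₀ * C₁ + 1) + 1) * β) < 6 / (24 * β + 3) := by
      rw [div_lt_div_iff₀ (by positivity) (by positivity)]
      have h1' : 16 * A₀ * C₁ * (24 * β + 3) ≤ 432 * (A₀ * C₁) * β := by nlinarith [hA0, hβ1]
      have h2' : 432 * (A₀ * C₁) * β < 6 * ((16 * 27 * (A₀ * C₁ + 1) + 1) * β) := by nlinarith [hA0, hβ1]
      linarith
    linarith
  · -- `A₀C₁ < 0`: the tolerance is negative, below the positive floor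
    have : A₀ * C₁ / (R : ℝ) ^ 4 < 0 := div_neg_of_neg_of_pos hAneg hRpos
    linarith

/-! ## §7 The same for tempered-d1's Dirichlet rate law (DR), the exterior-free floor of every (split)-type statement -/

/-- **(DR) pins the reference value below `N − Θ(1/β)`**: `DirichletRate C₁ A₀ β₁ ℓ₁ p` with `C₁ > 0` forces
`p q β ≤ 2 − 6/(24β+3) + C₁A₀/R⁴` at every admissible `(β, R)` with `β ≥ 0` (tempered-d1's `abs_sub_le_of_dirichletRate` + part 2's thermal floor of
the cold-wall kernel).  Weaker hypothesis than `pureSplitCl_ref_le` (every (split)-type stub implies (DR): `dirichletRate_of_pureSplitCl`,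
`dirichletRate_of_splitCl`). [folklore] -/
theorem dirichletRate_ref_le {C₁ A₀ β₁ ℓ₁ : ℝ} {p : Fin 4 × Fin 4 → ℝ → ℝ} (h : DirichletRate C₁ A₀ β₁ ℓ₁ p) (hC₁ : 0 < C₁)
    {β : ℝ} (hβ₁ : β₁ ≤ β) (hβ : 0 ≤ β) {R : ℕ} (hR : 1 ≤ R) (hRu : (R : ℝ) * Transport.uRec β ≤ ℓ₁)
    (q : Fin 4 × Fin 4) (hq : q.1 < q.2) :
    p q β ≤ 2 - 6 / (24 * β + 3) + C₁ * A₀ / (R : ℝ) ^ 4 := by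
  have h2 := abs_sub_le_of_dirichletRate hC₁ h hβ₁ hR hRu q hq 0
  have h3 := kerE_deficit_ge hβ R q hq 0 (1 : LGConfig 4 (Matrix.specialUnitaryGroup (Fin 2) ℂ))
  rw [kerE_const_sub (fundamentalLatticeRep 2) β _ _ 1 (continuous_plane (fundamentalLatticeRep 2) q 0)] at h3
  have h4 := (abs_le.1 h2).1
  linarith

/-- **A scale in the record's window below any prescribed polynomial tolerance**: for `ℓ₁ > 0`, `M ≥ 0` and any `β₀` there are `β ≥ β₀`, `β ≥ 1`
and `R ≥ 1` with `R·uRec β ≤ ℓ₁` and `M/R⁴ < 6/(24β+3)` (because `β·uRec(β)⁴ → 0`). [folklore] -/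
theorem exists_admissible_scale_below_floor {ℓ₁ M : ℝ} (hℓ₁ : 0 < ℓ₁) (hM : 0 ≤ M) (β₀ : ℝ) :
    ∃ (β : ℝ) (R : ℕ), β₀ ≤ β ∧ 1 ≤ β ∧ 1 ≤ R ∧ (R : ℝ) * Transport.uRec β ≤ ℓ₁ ∧ M / (R : ℝ) ^ 4 < 6 / (24 * β + 3) := by
  have hKpos : (0 : ℝ) < 16 * 27 * (M + 1) + 1 := by positivity
  have hev1 : ∀ᶠ β : ℝ in atTop, Transport.uRec β ≤ ℓ₁ / 2 :=
    (UnitTransfer.tendsto_uRec.eventually (Iic_mem_nhds (by positivity : (0 : ℝ) < ℓ₁ / 2)))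
  have hev2 : ∀ᶠ β : ℝ in atTop, β * Transport.uRec β ^ 4 ≤ ℓ₁ ^ 4 / (16 * 27 * (M + 1) + 1) :=
    tendsto_mul_uRec_pow_four.eventually (Iic_mem_nhds (by positivity))
  obtain ⟨β, hβ⟩ := (hev1.and (hev2.and ((eventually_ge_atTop β₀).and (eventually_ge_atTop (1 : ℝ))))).exists
  obtain ⟨hu, hβu, hβ0, hβ1⟩ := hβ
  have hupos : 0 < Transport.uRec β := UnitTransfer.uRec_pos β
  set R : ℕ := ⌊ℓ₁ / Transport.uRec β⌋₊ with hRdef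
  have hquot : 2 ≤ ℓ₁ / Transport.uRec β := by
    rw [le_div_iff₀ hupos]; linarith
  have hR1 : 1 ≤ R := by
    rw [hRdef]
    exact Nat.one_le_iff_ne_zero.2 (Nat.pos_iff_ne_zero.1 (Nat.floor_pos.2 (by linarith)))
  have hRle : (R : ℝ) ≤ ℓ₁ / Transport.uRec β := Nat.floor_le (by positivity)
  have hRu : (R : ℝ) * Transport.uRec β ≤ ℓ₁ := by rwa [← le_div_iff₀ hupos]
  have hRge : ℓ₁ / (2 * Transport.uRec β) ≤ (R : ℝ) := by
    have hlt := Nat.lt_floor_add_one (ℓ₁ / Transport.uRec β)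
    rw [← hRdef] at hlt
    rw [div_le_iff₀ (by positivity)]
    rw [le_div_iff₀ hupos] at hquot
    have : ℓ₁ / Transport.uRec β < R + 1 := hlt
    rw [div_lt_iff₀ hupos] at this
    nlinarith
  refine ⟨β, R, hβ0, hβ1, hR1, hRu, ?_⟩
  have hR4 : ℓ₁ ^ 4 / (16 * Transport.uRec β ^ 4) ≤ (R : ℝ) ^ 4 := by
    have h := pow_le_pow_left₀ (by positivity) hRge 4
    calc ℓ₁ ^ 4 / (16 * Transport.uRec β ^ 4) = (ℓ₁ / (2 * Transport.uRec β)) ^ 4 := by ring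
      _ ≤ (R : ℝ) ^ 4 := h
  have hRpos : (0 : ℝ) < (R : ℝ) ^ 4 := by positivity
  have hR4' : ℓ₁ ^ 4 ≤ (R : ℝ) ^ 4 * (16 * Transport.uRec β ^ 4) := (div_le_iff₀ (by positivity)).1 hR4
  have hb1 : M / (R : ℝ) ^ 4 ≤ M * (16 * Transport.uRec β ^ 4) / ℓ₁ ^ 4 := by
    rw [div_le_div_iff₀ hRpos (by positivity)]
    calc M * ℓ₁ ^ 4 ≤ M * ((R : ℝ) ^ 4 * (16 * Transport.uRec β ^ 4)) := mul_le_mul_of_nonneg_left hR4' hM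
      _ = M * (16 * Transport.uRec β ^ 4) * (R : ℝ) ^ 4 := by ring
  have hβu' : β * Transport.uRec β ^ 4 * (16 * 27 * (M + 1) + 1) ≤ ℓ₁ ^ 4 := (le_div_iff₀ hKpos).1 hβu
  have hb2 : M * (16 * Transport.uRec β ^ 4) / ℓ₁ ^ 4 ≤ 16 * M / ((16 * 27 * (M + 1) + 1) * β) := by
    rw [div_le_div_iff₀ (by positivity) (by positivity)]
    calc M * (16 * Transport.uRec β ^ 4) * ((16 * 27 * (M + 1) + 1) * β)
        = 16 * M * (β * Transport.uRec β ^ 4 * (16 * 27 * (M + 1) + 1)) := by ring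
      _ ≤ 16 * M * ℓ₁ ^ 4 := mul_le_mul_of_nonneg_left hβu' (by positivity)
  have hb3 : 16 * M / ((16 * 27 * (M + 1) + 1) * β) < 6 / (24 * β + 3) := by
    rw [div_lt_div_iff₀ (by positivity) (by positivity)]
    have h1' : 16 * M * (24 * β + 3) ≤ 432 * M * β := by nlinarith [hM, hβ1]
    have h2' : 432 * M * β < 6 * ((16 * 27 * (M + 1) + 1) * β) := by nlinarith [hM, hβ1]
    linarith
  linarith

/-- **THE CONSTANT REFERENCE IS INADMISSIBLE ALREADY FOR (DR)**: for all `C₁ > 0`, `A₀`, `β₁` and `ℓ₁ > 0`,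
`¬ DirichletRate C₁ A₀ β₁ ℓ₁ (fun _ _ => 2)` — the cold-wall centre-plane mean stays `≥ 6/(24β+3)` below `N = 2` on the whole scale window, while (DR)'s
tolerance `C₁A₀/R⁴` decays along it.  Through `dirichletRate_of_splitCl` / `dirichletRate_of_pureSplitCl` this covers every (split)-type stub with
positive thresholds. [folklore] -/
theorem not_dirichletRate_const_two {C₁ A₀ β₁ ℓ₁ : ℝ} (hC₁ : 0 < C₁) (hℓ₁ : 0 < ℓ₁) :
    ¬ DirichletRate C₁ A₀ β₁ ℓ₁ (fun _ _ => 2) := by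
  intro h
  rcases le_or_gt 0 (C₁ * A₀) with hA0 | hAneg
  · obtain ⟨β, R, hβ0, hβ1, hR1, hRu, hlt⟩ := exists_admissible_scale_below_floor hℓ₁ hA0 β₁
    have href := dirichletRate_ref_le h hC₁ hβ0 (by linarith) hR1 hRu (0, 1) (by decide)
    linarith
  · -- negative tolerance: (DR) fails at the first admissible point
    obtain ⟨β, R, hβ0, hβ1, hR1, hRu, -⟩ := exists_admissible_scale_below_floor hℓ₁ le_rfl β₁
    have href := dirichletRate_ref_le h hC₁ hβ0 (by linarith) hR1 hRu (0, 1) (by decide)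
    have hRpos : (0 : ℝ) < (R : ℝ) ^ 4 := by positivity
    have h6 : (0 : ℝ) < 6 / (24 * β + 3) := by positivity
    have : C₁ * A₀ / (R : ℝ) ^ 4 < 0 := div_neg_of_neg_of_pos hAneg hRpos
    linarith

/-! ## §8 The onset of the fixed-scale split with the trivial reference is at least quartic in the scale -/

/-- **ONSET LOWER BOUND FOR THE TRIVIAL REFERENCE.**  If at some `β ≥ 0` and scale `R ≥ 1` the flag-free split inequality with reference value `2 = N`
holds AT THE IDENTITY EXTERIOR, `(R⁴/C₁)|kerE^𝟙_β(plane q x) − 2| ≤ A₀ + carrierCl rF C_s 1 β R q x 𝟙` (the `η = 1` instance of the conclusion of the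
LEAD's `pureSplit_fixedScale`, p590468), then `6R⁴/C₁ ≤ A₀(24β + 3)`, i.e. `β ≥ R⁴/(4A₀C₁) − 1/8`: the carrier vanishes at the identity exterior
(`carrierCl_one`) while the cold-wall thermal deficit is `≥ 6/(24β+3)` (`kerE_deficit_ge`).  So the onset `β₁(R)` of the fixed-scale split with `p ≡ N`
grows at least like `R⁴` — against the `O(log R)` that (split-cl) along the record's window requires (`pureSplitCl_of_onset`, p590793). [folklore] -/
theorem onset_ge_of_split_const_at {β : ℝ} (hβ : 0 ≤ β) (R : ℕ) (q : Fin 4 × Fin 4) (hq : q.1 < q.2) (x : Fin 4 → ℤ)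
    {C_s C₁ A₀ : ℝ} (hC₁ : 0 < C₁)
    (h : (R : ℝ) ^ 4 / C₁ * |kerE (Matrix.specialUnitaryGroup (Fin 2) ℂ) (fundamentalLatticeRep 2) β (fun k => x k - (R + 1)) (2 * R + 3)
        (1 : LGConfig 4 (Matrix.specialUnitaryGroup (Fin 2) ℂ)) (plane (Matrix.specialUnitaryGroup (Fin 2) ℂ) (fundamentalLatticeRep 2) q x) - 2| ≤
        A₀ + carrierCl (fundamentalLatticeRep 2) C_s 1 β R q x 1) :
    6 * (R : ℝ) ^ 4 / C₁ ≤ A₀ * (24 * β + 3) := by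
  rw [carrierCl_one (fundamentalLatticeRep 2) C_s β R q hq x, add_zero] at h
  have h3 := kerE_deficit_ge hβ R q hq x (1 : LGConfig 4 (Matrix.specialUnitaryGroup (Fin 2) ℂ))
  rw [kerE_const_sub (fundamentalLatticeRep 2) β _ _ 1 (continuous_plane (fundamentalLatticeRep 2) q x)] at h3
  set k : ℝ := kerE (Matrix.specialUnitaryGroup (Fin 2) ℂ) (fundamentalLatticeRep 2) β (fun k => x k - (R + 1)) (2 * R + 3)
    (1 : LGConfig 4 (Matrix.specialUnitaryGroup (Fin 2) ℂ)) (plane (Matrix.specialUnitaryGroup (Fin 2) ℂ) (fundamentalLatticeRep 2) q x) with hk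
  have h24 : (0 : ℝ) < 24 * β + 3 := by linarith
  have hR4 : (0 : ℝ) ≤ (R : ℝ) ^ 4 / C₁ := by positivity
  -- `|k − 2| ≥ 2 − k ≥ 6/(24β+3)`
  have habs : 6 / (24 * β + 3) ≤ |k - 2| := by
    have : 2 - k ≤ |k - 2| := by rw [abs_sub_comm]; exact le_abs_self _
    linarith
  have h5 : (R : ℝ) ^ 4 / C₁ * (6 / (24 * β + 3)) ≤ A₀ := (mul_le_mul_of_nonneg_left habs hR4).trans h
  rw [div_mul_div_comm, div_le_iff₀ (by positivity)] at h5
  rw [div_le_iff₀ hC₁]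
  nlinarith [h5]

end Summit.QuantumFields.YangMills.Cruxes.UVSeamRec.ClassicalResponse.ThermalFloor

end
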